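import Summits.ABC.IUTFork.Cor312BridgeHypsPrVolArch
import Summits.ABC.IUTFork.Cor312ModelBoxesDHVolArch
import Summits.ABC.IUTFork.Cor312PilotIdelesPrProvenance
import HarnessLib

/-!
# [IUTchIII] Corollary 3.12 at the assembled real setting with BOTH repairs (print-normalised weights at the primes,
# honest archimedean place) and the Dupuy–Hilado pilot regions read off ideles — `BridgeHyps` UNCONDITIONALLY,
# `−|log(q)| = −deĝ(P_q) = −(1/2l)·log(q)`, provenance `IsSettingOf`, `Statement ↔ ↑(−deĝ(P_q)) ≤ −|log(Θ)|`

Record file (D-0012) of the abc-iut cell (Cor. 3.12 sub-crew, seat abc-iut-c312-7, gen 3; TEAM A row A-0 coda «A-0 AT THE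
PRINT-NORMALISED SETTING», fourth corner; OFFER to abc-iut-w5-d163 on HOME/STATUS 06:15:21Z, no answer — built over THEIR
landed/filed chain `Cor312SettingPrVolArch` (p424959) … `Cor312BridgeHypsPrVolArch` BY NAME); TAKES NO SIDE. abc-iut-w5-d163's
`Real.settingPrVolArch` carries abc-iut-c312-1's probability weights at the primes (F-c312-1-g5-1) AND their honest archimedean
pieces ([IUTchIV] Prop. 1.5 (iii); Step (vii) container `π^{j+1}·B_I`). THIS file supplies its pilot binders from IDELES, as
abc-iut-c312-3 did at `settingDHVol` (`Cor312PilotIdelesDH`) and this seat at `settingPrVol` (`Cor312PilotIdelesPr`):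

* §1 defs **`thetaBoxDHArchSharp t`** (at a prime: abc-iut-c312-3's sharp box `ι_j(t_{Θ,j,v_j})·(R_I)^∼` through `boxOf`; at `∞`:
  abc-iut-w5-d163's Step (vii) container `archContainer` — their honest-`∞` reading of the (Ind3)-union, [IUTchIV] Thm. 1.10
  Step (vii) p. 30) and **`qCentreDHArch tq`** (at a prime: `qCentreDH`; at `∞`: the centre `1`, i.e. the unit polydisc
  `B_I` — the trivial archimedean fibre of `𝒪_𝕃(−P_q)`); `hq`; the `q`-volume at `∞` is `0` (`logvol_qRegion_PrArch_inl`: `B_I ↦ 0`,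
  abc-iut-w5-d043 `logvol_unitStructure_arch`) and at a prime it is the print-normalised one (`…_inr`, definitionally);
* §2 **`settingPrVolArchSharp`** and **`bridgeHyps_settingPrVolArchSharp_of_ideles`** — EVERY field of abc-iut-c312-6's `BridgeHyps`
  a theorem, residual = the idele binders (w5-d163 `bridgeHyps_settingPrVolArch_of_hullSets` fed with abc-iut-c312-3's
  `isHullSet_thetaBoxDH_sharp` / `finite_ne_unitBox_sharp`; the `∞` clause holds by construction);
* §3 the `q`-NUMBER **`negLogQ_settingPrVolArchSharp = −FinDivisor.ndeg F X.qPilot`** for `q`-ideles realising `P_q` (DH (3.4)) — no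
  archimedean correction on the `q`-side —, `= −absLogq D` under `IsPilotDataOf D X`, `AbsLogQPos`;
  **`statement_settingPrVolArchSharp_iff : Statement ↔ ↑(−ndeg F X.qPilot) ≤ negLogTheta`**;
* §4 provenance **`isSettingOf_settingPrVolArchSharp`** from `IsPilotDataOf D X` + the index bijection `hplaces` + realising `q`-ideles.
[claim: Mochizuki2012, status: disputed] for the quoted setting; [cite: DupuyHilado2025, §3.4, §3.6, §3.9]; [cite: Mochizuki2012, IUTchIV
Prop. 1.5 (iii) p. 15, Thm. 1.10 p. 23, Step (vii) p. 30]. HONEST FRAMING: the `∞`-component of the Θ-boxes is w5-d163's container MODEL (their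
`Cor312ModelBoxesPrVolArch`), not a reading of the author's archimedean Kummer images; the Θ-side numbers at `∞` are theirs
(`thetaLocal_settingPrVolArch_inl_of_eq`: `(j+1)·log π`). Nothing asserted or denied about Cor. 3.12. typed ≠ proved; instantiated ≠ endorsed.
-/

noncomputable section

open Set Function NumberField IsDedekindDomain
open scoped Pointwise

namespace Summit.ABC

namespace IUTFork

namespace Thm311

namespace Real

open Cor312 Cor312Vol Cor312Prov Literature.IUT.LogThetaLattice Literature.IUT.LogVolume Literature.IUT.HodgeTheaters

variable {F : Type} [Field F] [NumberField F] (X : PilotData F) {logv : PadicLogs F} (hlog : LogvAnalytic logv)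
  (hc : ∀ w : InfinitePlace F, w.IsComplex)

/-! ## §1. The pilot binders from ideles, archimedean place honest -/

section Defs

variable (t : ∀ (pp : Nat.Primes) (_ : Fin X.lstar) (x : (thetaIndex X).Fibre (.inr pp)),
    haveI : Fact (pp : ℕ).Prime := ⟨pp.2⟩; kOf X pp.1 x)
  (tq : ∀ (pp : Nat.Primes) (x : (thetaIndex X).Fibre (.inr pp)), haveI : Fact (pp : ℕ).Prime := ⟨pp.2⟩; kOf X pp.1 x)

/-- **The Θ-boxes from Θ-ideles, archimedean place honest**: at a prime abc-iut-c312-3's sharp box `ι_j(t_{Θ,j,v_j})·(R_I)^∼`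
(through `boxOf`), at `∞` abc-iut-w5-d163's Step (vii) container `π^{j+1}·B_I` (their honest-`∞` model of the (Ind3)-union).
[claim: Mochizuki2012, status: disputed] -/
def thetaBoxDHArchSharp : ∀ (j : (thetaIndex X).Label) (vQ : (thetaIndex X).VQ),
    Set (∀ s : factorIdxDHArch X hlog j vQ, factorFieldDHArch X hlog j vQ s)
  | j, .inl _ => archContainer X hlog j
  | j, .inr pp => haveI : Fact (pp : ℕ).Prime := ⟨pp.2⟩; (presAt X hlog pp).boxOf (sharpBoxDH X hlog t pp j)

/-- **The `q`-centre from `q`-ideles, archimedean place honest**: at a prime abc-iut-c312-3's `qCentreDH`, at `∞` the centre `1`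
(the `q`-pilot line bundle has trivial archimedean fibre: the unit polydisc `B_I`). [claim: Mochizuki2012, status: disputed] -/
def qCentreDHArch : ∀ (j : (thetaIndex X).Label) (vQ : (thetaIndex X).VQ),
    ∀ s : factorIdxDHArch X hlog j vQ, factorFieldDHArch X hlog j vQ s
  | _, .inl _ => fun _ => 1
  | j, .inr pp => qCentreDH X hlog tq j (.inr pp)

/-- At a prime the honest-`∞` box family IS abc-iut-c312-3's sharp DH box family. [folklore] -/
theorem thetaBoxDHArchSharp_inr (j : (thetaIndex X).Label) (pp : Nat.Primes) :
    thetaBoxDHArchSharp X hlog t j (.inr pp) = thetaBoxDH X hlog (sharpBoxDH X hlog t) j (.inr pp) :=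
  rfl

/-- At `∞` the box is the Step (vii) container. [folklore] -/
theorem thetaBoxDHArchSharp_inl (j : (thetaIndex X).Label) :
    thetaBoxDHArchSharp X hlog t j (.inl ()) = archContainer X hlog j :=
  rfl

/-- **`hq`**: every component of the `q`-centre is non-zero. [folklore] -/
theorem qCentreDHArch_ne_zero (htq0 : ∀ pp x, tq pp x ≠ 0) :
    ∀ (j : (thetaIndex X).Label) (vQ : (thetaIndex X).VQ) (s : factorIdxDHArch X hlog j vQ),
      qCentreDHArch X hlog tq j vQ s ≠ 0
  | _, .inl _, _ => one_ne_zero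
  | j, .inr pp, s => qCentreDH_ne_zero X hlog tq htq0 j (.inr pp) s

/-- At `∞` the `q`-pilot region `e⁻¹(1·𝒪_L)` is the pull-back of the unit structure `B_I`. [folklore] -/
theorem preimage_hullSet_qCentreDHArch_inl (j : (thetaIndex X).Label) :
    factorMapDHArch X hlog hc j (.inl ()) ⁻¹' hullSet (factorFieldDHArch X hlog j (.inl ()))
        (qCentreDHArch X hlog tq j (.inl ())) =
      (archPresentationDH X logv hc).comparison j ⁻¹'
        Literature.IUT.LogVolume.Prop15iii.ball (ArchPresentation.Φ₀ (T := thetaIndex X) (Sum.inl ()) j) := by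
  rw [factorMapDHArch_preimage_hullSet_inl]
  congr 1
  ext x
  simp only [Set.mem_preimage, ArchPacket.polydisc, Set.mem_setOf_eq, Literature.IUT.LogVolume.Prop15iii.ball,
    qCentreDHArch, norm_one]

variable (M : Type) [Field M] [NumberField M]
  (archPk : ∀ (j : (thetaIndex X).Label) (vQ : (thetaIndex X).VQ), Set ((logShellsDH X logv).Packet j vQ))
  (archSub : ∀ (j : (thetaIndex X).Label) (v : (thetaIndex X).V),
    Set ((logShellsDH X logv).Packet j ((thetaIndex X).over v)))
  (Ψ : ℤ → ∀ v : (thetaIndex X).V, v ∈ (thetaIndex X).Vbad → Set ((logShellsDH X logv).StarPacket v))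
  (act : ℤ → ∀ v : (thetaIndex X).V, v ∈ (thetaIndex X).Vbad →
    (logShellsDH X logv).StarPacket v → Module.End ℚ ((logShellsDH X logv).StarPacket v))
  (Mmod : ℤ → ∀ j : (thetaIndex X).LabelStar, Set ((logShellsDH X logv).GlobalPacket j.1))
  (region : ℤ → ∀ j : (thetaIndex X).LabelStar, FinDivisor M → ∀ vQ : (thetaIndex X).VQ,
    Set ((logShellsDH X logv).Packet j.1 vQ))
  (n : ℤ)

/-- **The `q`-volume at `∞` is `0`** (`B_I ↦ 0`, abc-iut-w5-d043 `logvol_unitStructure_arch`: no archimedean term on the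
`q`-side, as in print). [cite: Mochizuki2012, IUTchIV Thm 1.10 proof Step (vii) p. 30] -/
theorem logvol_qRegion_PrArch_inl (j : (thetaIndex X).Label) :
    ((situationDHVolPrArch X hlog hc M archPk archSub Ψ act Mmod region).D n).logvol j (.inl ())
      (factorMapDHArch X hlog hc j (.inl ()) ⁻¹' hullSet (factorFieldDHArch X hlog j (.inl ()))
        (qCentreDHArch X hlog tq j (.inl ()))) = 0 :=
  (congrArg (((situationDHVolPrArch X hlog hc M archPk archSub Ψ act Mmod region).D n).logvol j (.inl ()))
    (preimage_hullSet_qCentreDHArch_inl X hlog hc tq j)).trans (logvol_unitStructure_arch X hlog hc j)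

/-- **At a prime the `q`-volume of the fourth-corner setting is the print-normalised one** (the merged container IS
abc-iut-c312-1's at the primes, abc-iut-w5-d043 `summandPiecesPrArch_logvol_inr`; this seat's `logvol_qRegion_Pr_inr`). [folklore] -/
theorem logvol_qRegion_PrArch_inr (htq0 : ∀ pp x, tq pp x ≠ 0) (j : (thetaIndex X).Label) (pp : Nat.Primes) :
    ((situationDHVolPrArch X hlog hc M archPk archSub Ψ act Mmod region).D n).logvol j (.inr pp)
      (factorMapDHArch X hlog hc j (.inr pp) ⁻¹' hullSet (factorFieldDHArch X hlog j (.inr pp))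
        (qCentreDHArch X hlog tq j (.inr pp))) =
      haveI : Fact (pp : ℕ).Prime := ⟨pp.2⟩
      ∑ e : (presAt X hlog pp).toLocalPieces.E j, weightPr X pp.1 j e * Real.log ‖tq pp (e (Fin.last _))‖ :=
  logvol_qRegion_Pr_inr X hlog M archPk archSub Ψ act Mmod region n tq htq0 j pp

/-- **`hfin`**: the `q`-volume is supported on `{∞} ∪` the primes under `S` (for `q`-ideles that are units off `S`). [folklore] -/
theorem finite_support_logvol_qRegion_PrArch (htq0 : ∀ pp x, tq pp x ≠ 0)
    (htq1 : ∀ (pp : Nat.Primes) (x : (thetaIndex X).Fibre (.inr pp)),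
      haveI : Fact (pp : ℕ).Prime := ⟨pp.2⟩; placeOf X pp.1 x ∉ X.S → ‖tq pp x‖ = 1)
    (j : (thetaIndex X).Label) :
    (Function.support fun vQ => ((situationDHVolPrArch X hlog hc M archPk archSub Ψ act Mmod region).D n).logvol j vQ
      (factorMapDHArch X hlog hc j vQ ⁻¹' hullSet (factorFieldDHArch X hlog j vQ) (qCentreDHArch X hlog tq j vQ))).Finite := by
  refine ((Set.finite_range (Sum.inl : Unit → (thetaIndex X).VQ)).union
    (finite_support_logvol_qRegion_Pr X hlog M archPk archSub Ψ act Mmod region n tq htq0 htq1 j)).subset ?_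
  intro vQ hvQ
  rcases vQ with u | pp
  · exact Or.inl ⟨u, rfl⟩
  · exact Or.inr hvQ

end Defs

/-! ## §2. The setting with every pilot binder supplied; `BridgeHyps` UNCONDITIONALLY -/

section Setting

variable (M : Type) [Field M] [NumberField M]
  (archPk : ∀ (j : (thetaIndex X).Label) (vQ : (thetaIndex X).VQ), Set ((logShellsDH X logv).Packet j vQ))
  (archSub : ∀ (j : (thetaIndex X).Label) (v : (thetaIndex X).V),
    Set ((logShellsDH X logv).Packet j ((thetaIndex X).over v)))
  (Ψ : ℤ → ∀ v : (thetaIndex X).V, v ∈ (thetaIndex X).Vbad → Set ((logShellsDH X logv).StarPacket v))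
  (act : ℤ → ∀ v : (thetaIndex X).V, v ∈ (thetaIndex X).Vbad →
    (logShellsDH X logv).StarPacket v → Module.End ℚ ((logShellsDH X logv).StarPacket v))
  (Mmod : ℤ → ∀ j : (thetaIndex X).LabelStar, Set ((logShellsDH X logv).GlobalPacket j.1))
  (region : ℤ → ∀ j : (thetaIndex X).LabelStar, FinDivisor M → ∀ vQ : (thetaIndex X).VQ,
    Set ((logShellsDH X logv).Packet j.1 vQ))
  (n : ℤ) {HT : Type} {LogLink : HT → HT → Type} {IsFull : ∀ {s t : HT}, LogLink s t → Prop}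
  (lat : LGPGaussianLogThetaLattice LogLink IsFull)
  {Frd : Type} {IsoF : Frd → Frd → Type} {Ob : Frd → Type} {realify : Frd → Frd} {Strip : Type}
  {IsoS : Strip → Strip → Type} {Mv : ∀ v : (thetaIndex X).V, v ∈ (thetaIndex X).Vbad → Type}
  [∀ v h, Monoid (Mv v h)]
  (sig : GlobalLGPFrobenioidSignature (thetaIndex X).lstar (thetaIndex X).V (· ∈ (thetaIndex X).Vbad)
    Frd IsoF Ob realify Strip IsoS Mv)
  (split : SplittingMonoids Mv) {ObΔ : Type} {N : ∀ v : (thetaIndex X).V, v ∈ (thetaIndex X).Vbad → Type}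
  [∀ v h, Monoid (N v h)] (qData : QPilotData ObΔ N)
  (t : ∀ (pp : Nat.Primes) (_ : Fin X.lstar) (x : (thetaIndex X).Fibre (.inr pp)),
    haveI : Fact (pp : ℕ).Prime := ⟨pp.2⟩; kOf X pp.1 x)
  (tq : ∀ (pp : Nat.Primes) (x : (thetaIndex X).Fibre (.inr pp)), haveI : Fact (pp : ℕ).Prime := ⟨pp.2⟩; kOf X pp.1 x)

/-- **The setting of [IUTchIII] Cor. 3.12 over the REAL log-shells of `F` with BOTH repairs and the pilot regions read off ideles**:
abc-iut-w5-d163's `settingPrVolArch` with the Θ-boxes `thetaBoxDHArchSharp t`, the `q`-centre `qCentreDHArch tq`, `hq`, `hfin` SUPPLIED.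
Binders left: `n`, `lat`/`sig`/`split`/`qData`, the situation's archimedean structures and (b)(c) data, "`√−1 ∈ F`" (`hc`), the
ideles. [claim: Mochizuki2012, status: disputed] -/
def settingPrVolArchSharp (htq0 : ∀ pp x, tq pp x ≠ 0)
    (htq1 : ∀ (pp : Nat.Primes) (x : (thetaIndex X).Fibre (.inr pp)),
      haveI : Fact (pp : ℕ).Prime := ⟨pp.2⟩; placeOf X pp.1 x ∉ X.S → ‖tq pp x‖ = 1) :
    Cor312.Setting (situationDHVolPrArch X hlog hc M archPk archSub Ψ act Mmod region) :=
  settingPrVolArch X hlog hc M archPk archSub Ψ act Mmod region n lat sig split qData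
    (fun _ _ => thetaBoxDHArchSharp X hlog t) (fun _ => qCentreDHArch X hlog tq)
    (qCentreDHArch_ne_zero X hlog tq htq0)
    (finite_support_logvol_qRegion_PrArch X hlog hc tq M archPk archSub Ψ act Mmod region n htq0 htq1)

/-- **abc-iut-c312-6's `BridgeHyps` at the fourth corner with pilot regions from ideles — EVERY FIELD A THEOREM**
(abc-iut-w5-d163 `bridgeHyps_settingPrVolArch_of_hullSets`: at `∞` the boxes ARE the container; at every `(j ∈ 𝔽_l^⋇, p)` the box
is the hull-set `λ_Θ·𝒪_L` (abc-iut-c312-3 `isHullSet_thetaBoxDH_sharp`), `= 𝒪_L` off the primes under `S` (`finite_ne_unitBox_sharp`)).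
Residual: the idele binders. [claim: Mochizuki2012, status: disputed] -/
theorem bridgeHyps_settingPrVolArchSharp_of_ideles (ht0 : ∀ pp i x, t pp i x ≠ 0)
    (ht1 : ∀ (pp : Nat.Primes) (i : Fin X.lstar) (x : (thetaIndex X).Fibre (.inr pp)),
      haveI : Fact (pp : ℕ).Prime := ⟨pp.2⟩; placeOf X pp.1 x ∉ X.S → ‖t pp i x‖ = 1)
    (htq0 : ∀ pp x, tq pp x ≠ 0)
    (htq1 : ∀ (pp : Nat.Primes) (x : (thetaIndex X).Fibre (.inr pp)),
      haveI : Fact (pp : ℕ).Prime := ⟨pp.2⟩; placeOf X pp.1 x ∉ X.S → ‖tq pp x‖ = 1) :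
    BridgeHyps (settingPrVolArchSharp X hlog hc M archPk archSub Ψ act Mmod region n lat sig split qData t tq htq0 htq1) := by
  refine bridgeHyps_settingPrVolArch_of_hullSets X hlog hc M archPk archSub Ψ act Mmod region n lat sig split qData _ _ _
    (fun i => ?_) (fun i pp => ?_) (fun i => ?_)
  · exact Set.iUnion_const _
  · rw [Set.iUnion_const]
    exact isHullSet_thetaBoxDH_sharp X hlog t ht0 (Setting.labelSucc i) (.inr pp)
  · refine (finite_ne_unitBox_sharp X hlog t ht0 ht1 i).subset fun pp hpp => ?_
    rwa [Set.mem_setOf_eq, Set.iUnion_const] at hpp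

/-- **`ThetaFinite` ("`−|log(Θ)| ∈ ℝ`") at the fourth corner with pilot regions from ideles** — the `finite` field of `BridgeHyps`.
[claim: Mochizuki2012, status: disputed] -/
theorem thetaFinite_settingPrVolArchSharp (ht0 : ∀ pp i x, t pp i x ≠ 0)
    (ht1 : ∀ (pp : Nat.Primes) (i : Fin X.lstar) (x : (thetaIndex X).Fibre (.inr pp)),
      haveI : Fact (pp : ℕ).Prime := ⟨pp.2⟩; placeOf X pp.1 x ∉ X.S → ‖t pp i x‖ = 1)
    (htq0 : ∀ pp x, tq pp x ≠ 0)
    (htq1 : ∀ (pp : Nat.Primes) (x : (thetaIndex X).Fibre (.inr pp)),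
      haveI : Fact (pp : ℕ).Prime := ⟨pp.2⟩; placeOf X pp.1 x ∉ X.S → ‖tq pp x‖ = 1) :
    (settingPrVolArchSharp X hlog hc M archPk archSub Ψ act Mmod region n lat sig split qData t tq htq0 htq1).ThetaFinite :=
  (bridgeHyps_settingPrVolArchSharp_of_ideles X hlog hc M archPk archSub Ψ act Mmod region n lat sig split qData t tq ht0 ht1 htq0
    htq1).finite

/-- **Every box of `thetaBoxDHArchSharp` is a hull-set**: at `∞` the container is `λ·𝒪` with `λ = Φ₀(⊗_i (π)_v)` (abc-iut-w5-d163
`archContainer_eq_hullSet`), at a prime the sharp box is `λ_Θ·𝒪_L` (abc-iut-c312-3 `isHullSet_thetaBoxDH_sharp`).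
[cite: Mochizuki2012, IUTchIII Rmk. 3.9.5 (ix) p. 128] -/
theorem isHullSet_thetaBoxDHArchSharp (ht0 : ∀ pp i x, t pp i x ≠ 0) (j : (thetaIndex X).Label) :
    ∀ vQ : (thetaIndex X).VQ, IsHullSet (factorFieldDHArch X hlog j vQ) (thetaBoxDHArchSharp X hlog t j vQ)
  | .inl u => by
    cases u
    exact ⟨archMaxPoint X hlog j, fun s => by
      rw [← norm_ne_zero_iff, norm_archMaxPoint]
      exact (pow_pos Real.pi_pos _).ne', archContainer_eq_hullSet X hlog j⟩
  | .inr pp => isHullSet_thetaBoxDH_sharp X hlog t ht0 j (.inr pp)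

/-- **abc-iut-c312-11's `ThetaRegionsAdm` at the fourth corner with pilot regions from ideles** — every `(n, m)`-Kummer image is
admissible, at `∞` too (abc-iut-w5-d163 `thetaRegionsAdm_settingPrVolArch_of_isHullSet`). [claim: Mochizuki2012, status: disputed] -/
theorem thetaRegionsAdm_settingPrVolArchSharp (ht0 : ∀ pp i x, t pp i x ≠ 0) (htq0 : ∀ pp x, tq pp x ≠ 0)
    (htq1 : ∀ (pp : Nat.Primes) (x : (thetaIndex X).Fibre (.inr pp)),
      haveI : Fact (pp : ℕ).Prime := ⟨pp.2⟩; placeOf X pp.1 x ∉ X.S → ‖tq pp x‖ = 1) :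
    ThetaRegionsAdm (settingPrVolArchSharp X hlog hc M archPk archSub Ψ act Mmod region n lat sig split qData t tq htq0 htq1) :=
  thetaRegionsAdm_settingPrVolArch_of_isHullSet X hlog hc M archPk archSub Ψ act Mmod region n lat sig split qData _ _ _ _
    fun _ i vQ => isHullSet_thetaBoxDHArchSharp X hlog t ht0 (Setting.labelSucc i) vQ

/-- **The printed `Statement` at the fourth corner ⟸ TEAM B's gap input `GlobalVolumeTransport` ALONE** (G-c312-11-1 — NOT asserted;
abc-iut-w5-d163 `statement_settingPrVolArch_of_globalVolumeTransport` with its side conditions discharged for the idele boxes).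
[claim: Mochizuki2012, status: disputed] -/
theorem statement_settingPrVolArchSharp_of_globalVolumeTransport (ht0 : ∀ pp i x, t pp i x ≠ 0)
    (ht1 : ∀ (pp : Nat.Primes) (i : Fin X.lstar) (x : (thetaIndex X).Fibre (.inr pp)),
      haveI : Fact (pp : ℕ).Prime := ⟨pp.2⟩; placeOf X pp.1 x ∉ X.S → ‖t pp i x‖ = 1)
    (htq0 : ∀ pp x, tq pp x ≠ 0)
    (htq1 : ∀ (pp : Nat.Primes) (x : (thetaIndex X).Fibre (.inr pp)),
      haveI : Fact (pp : ℕ).Prime := ⟨pp.2⟩; placeOf X pp.1 x ∉ X.S → ‖tq pp x‖ = 1)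
    (hgvt : GlobalVolumeTransport
      (settingPrVolArchSharp X hlog hc M archPk archSub Ψ act Mmod region n lat sig split qData t tq htq0 htq1)) :
    (settingPrVolArchSharp X hlog hc M archPk archSub Ψ act Mmod region n lat sig split qData t tq htq0 htq1).Statement :=
  statement_settingPrVolArch_of_globalVolumeTransport X hlog hc M archPk archSub Ψ act Mmod region n lat sig split qData _ _ _ _
    (fun _ i vQ => isHullSet_thetaBoxDHArchSharp X hlog t ht0 (Setting.labelSucc i) vQ)
    (thetaFinite_settingPrVolArchSharp X hlog hc M archPk archSub Ψ act Mmod region n lat sig split qData t tq ht0 ht1 htq0 htq1)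
    hgvt

/-! ## §3. The `q`-NUMBER: `−|log(q)| = −deĝ(P_q)` (no archimedean correction), `|log(q)| > 0`, the residue of the Statement -/

variable (htq0 : ∀ pp x, tq pp x ≠ 0)
  (htq1 : ∀ (pp : Nat.Primes) (x : (thetaIndex X).Fibre (.inr pp)),
    haveI : Fact (pp : ℕ).Prime := ⟨pp.2⟩; placeOf X pp.1 x ∉ X.S → ‖tq pp x‖ = 1)
  (htq : ∀ (pp : Nat.Primes) (x : (thetaIndex X).Fibre (.inr pp)),
    haveI : Fact (pp : ℕ).Prime := ⟨pp.2⟩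
    Real.log ‖tq pp x‖ = -(X.qPilot (placeOf X pp.1 x)) * logNorm F (placeOf X pp.1 x) /
      localDegree F (placeOf X pp.1 x))

/-- The local `q`-volumes of the fourth-corner setting AGREE with those of this seat's print-normalised setting `settingPrVolSharp` at every
`v_ℚ` (at `∞`: both `0`; at a prime: the same container). [folklore] -/
theorem qLocal_settingPrVolArchSharp_eq (j : (thetaIndex X).Label) (vQ : (thetaIndex X).VQ) :
    (settingPrVolArchSharp X hlog hc M archPk archSub Ψ act Mmod region n lat sig split qData t tq htq0 htq1).qLocal j vQ =
      (settingPrVolSharp X hlog M archPk archSub Ψ act Mmod region n lat sig split qData tq t htq0 htq1).qLocal j vQ := by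
  rcases vQ with u | pp
  · cases u
    rw [show (settingPrVolSharp X hlog M archPk archSub Ψ act Mmod region n lat sig split qData tq t htq0 htq1).qLocal j
        (.inl ()) = 0 from qLocal_settingPrVol_qCentreDH_inl X hlog M archPk archSub Ψ act Mmod region n lat sig split qData _ tq
        htq0 _ j ()]
    exact logvol_qRegion_PrArch_inl X hlog hc tq M archPk archSub Ψ act Mmod region n j
  · rfl

include htq in
/-- **`−|log(q)| = −deĝ(P_q)` at the fourth corner** for `q`-ideles realising `P_q`: the archimedean `q`-volume is `0`, the prime part is
this seat's `negLogQ_settingPrVolSharp` (p424856). [cite: DupuyHilado2025, §3.4, Thm. 3.10.1] -/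
theorem negLogQ_settingPrVolArchSharp :
    (settingPrVolArchSharp X hlog hc M archPk archSub Ψ act Mmod region n lat sig split qData t tq htq0 htq1).negLogQ =
      -FinDivisor.ndeg F X.qPilot := by
  rw [← negLogQ_settingPrVolSharp X hlog M archPk archSub Ψ act Mmod region n lat sig split qData t tq htq0 htq1 htq]
  unfold Setting.negLogQ
  congr 1
  funext i
  exact finsum_congr fun vQ => qLocal_settingPrVolArchSharp_eq X hlog hc M archPk archSub Ψ act Mmod region n lat sig split qData t
    tq htq0 htq1 _ vQ

include htq in
/-- **`−|log(q)| = −(1/2l)·log(q)` of the initial Θ-data at the fourth corner**, under `IsPilotDataOf D X` ([IUTchIV] Thm. 1.10 p. 23).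
[claim: Mochizuki2012, status: disputed] -/
theorem negLogQ_settingPrVolArchSharp_eq_neg_absLogq {K Fbar : Type} [Field K] [NumberField K] [Algebra F K] [Field Fbar]
    [Algebra F Fbar] [Algebra K Fbar] {E : WeierstrassCurve F} [E.IsElliptic] {l : ℕ} {Pb : BadPlacePredicates K}
    {D : InitialThetaData F K Fbar E l Pb} (hX : IsPilotDataOf D X) :
    (settingPrVolArchSharp X hlog hc M archPk archSub Ψ act Mmod region n lat sig split qData t tq htq0 htq1).negLogQ =
      -absLogq D := by
  rw [negLogQ_settingPrVolArchSharp X hlog hc M archPk archSub Ψ act Mmod region n lat sig split qData t tq htq0 htq1 htq,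
    absLogq_eq_ndeg_qPilot hX]

include htq in
/-- **"`|log(q)| > 0`"** at the fourth corner for realising `q`-ideles. [claim: Mochizuki2012, status: disputed] -/
theorem absLogQPos_settingPrVolArchSharp :
    (settingPrVolArchSharp X hlog hc M archPk archSub Ψ act Mmod region n lat sig split qData t tq htq0 htq1).AbsLogQPos := by
  unfold Setting.AbsLogQPos
  rw [negLogQ_settingPrVolArchSharp X hlog hc M archPk archSub Ψ act Mmod region n lat sig split qData t tq htq0 htq1 htq, neg_lt_zero,
    FinDivisor.ndeg_apply]
  exact div_pos X.deg_qPilot_pos FinDivisor.finrank_pos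

include htq in
/-- **THE RESIDUE OF THE PRINTED STATEMENT at the fourth corner with pilot regions from realising ideles**: `Statement ↔
↑(−deĝ(P_q)) ≤ −|log(Θ)|` — the first conjunct is a theorem, the `q`-side a number; the Θ-side (which here INCLUDES abc-iut-w5-d163's
archimedean `(j+1)·log π` terms) is the adjudication's object, not asserted, not denied. [claim: Mochizuki2012, status: disputed] -/
theorem statement_settingPrVolArchSharp_iff (ht0 : ∀ pp i x, t pp i x ≠ 0)
    (ht1 : ∀ (pp : Nat.Primes) (i : Fin X.lstar) (x : (thetaIndex X).Fibre (.inr pp)),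
      haveI : Fact (pp : ℕ).Prime := ⟨pp.2⟩; placeOf X pp.1 x ∉ X.S → ‖t pp i x‖ = 1) :
    (settingPrVolArchSharp X hlog hc M archPk archSub Ψ act Mmod region n lat sig split qData t tq htq0 htq1).Statement ↔
      (((-FinDivisor.ndeg F X.qPilot : ℝ) : WithTop ℝ) ≤
        (settingPrVolArchSharp X hlog hc M archPk archSub Ψ act Mmod region n lat sig split qData t tq htq0 htq1).negLogTheta) := by
  have hfin := thetaFinite_settingPrVolArchSharp X hlog hc M archPk archSub Ψ act Mmod region n lat sig split qData t tq ht0 ht1 htq0 htq1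
  have hne : (settingPrVolArchSharp X hlog hc M archPk archSub Ψ act Mmod region n lat sig split qData t tq htq0 htq1).negLogTheta ≠ ⊤ := by
    unfold Setting.negLogTheta
    rw [if_pos hfin]
    exact WithTop.coe_ne_top
  unfold Setting.Statement
  rw [negLogQ_settingPrVolArchSharp X hlog hc M archPk archSub Ψ act Mmod region n lat sig split qData t tq htq0 htq1 htq]
  exact ⟨fun h => h.2, fun h => ⟨hne, h⟩⟩

/-! ## §4. Provenance -/

include htq in
/-- **`IsSettingOf D P` at the fourth corner** from `IsPilotDataOf D X`, the index bijection `hplaces` and realising `q`-ideles (the `q`-number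
field by §3, the others as in this seat's `isSettingOf_settingPrVolSharp`). [claim: Mochizuki2012, status: disputed] -/
theorem isSettingOf_settingPrVolArchSharp {K Fbar : Type} [Field K] [NumberField K] [Algebra F K] [Field Fbar]
    [Algebra F Fbar] [Algebra K Fbar] {E : WeierstrassCurve F} [E.IsElliptic] {l : ℕ} {Pb : BadPlacePredicates K}
    {D : InitialThetaData F K Fbar E l Pb} (hX : IsPilotDataOf D X)
    (hplaces : ∃ e : (thetaIndex X).V ≃ D.V, ∀ v : (thetaIndex X).V,
      v ∈ (thetaIndex X).Vbad ↔ ((e v : D.V) : Val K) ∈ D.Vbad) :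
    IsSettingOf D (settingPrVolArchSharp X hlog hc M archPk archSub Ψ act Mmod region n lat sig split qData t tq htq0 htq1) where
  lstar_eq := lstar_thetaIndex_eq_of_isPilotDataOf X hX
  places := hplaces
  VFbad_finite := vFbad_finite D
  negLogQ_eq := negLogQ_settingPrVolArchSharp_eq_neg_absLogq X hlog hc M archPk archSub Ψ act Mmod region n lat sig split qData t tq
    htq0 htq1 htq hX

end Setting

end Real

end Thm311

end IUTFork

end Summit.ABC

end
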